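import Summits.BirchSwinnertonDyer.Rank1Residual.Additive.X3BranchResidualCountOfCharacterFacts
import Summits.BirchSwinnertonDyer.Rank1Residual.Additive.X3BranchCertificateRoadGord
import Literature.NumberTheory.EllipticCurves.GreenbergVatsal2000.ResidualLiftingEven
import HarnessLib

/-!
# X3♯(G-ord, `e = 2`), NON-degenerate rows, rank `0`: the CERTIFICATE-ROAD end states with the
# residual-count evaluation `hn` DISCHARGED by the character sentences of GV pp. 41–42 at a twist —
# `BSD(E,p)` (`p ≥ 5`, ramified even line; `p = 3`, non-degenerate line) from PUBLISHED records + the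
# line datum + THREE per-pair instrument certificates (`hcert`, `hCcert`, `hDcert`), with NO analytic
# congruence `hGV` (cell `bsd-eis`, seat `bsd-eis-x3` gen 3; route K1 `AdditiveBranchIMC`, crux
# `GordTwoRankZeroOffCaseOne` — supports only)

HONEST FRAMING (cell `bsd-eis`, `run/shared/lean/pub/bsd-eis/README.md` §4): THEOREMS ONLY (no
`def`, no named fact, no `sorry`); nothing is booked by this file; NOT a class theorem. Binder diff
w.r.t. the gen-2 end states of `X3BranchCertificateRoadGord.lean` §2–§3: {`hn`} ↦ {`hC`, `hD` (the
PUBLISHED twisted character facts of `CharacterInvariantsTwisted.lean`), `hCcert`, `hDcert` (two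
ANALYTIC `λ`-certificates), `hab : a + b = n + Σ_{v∈Σ₀} δ_v(W)`} — see the (M) sibling
`X3BranchCertificateRoadMultOfCharacterFacts.lean`. On the (G-ord, `e = 2`) rows bsd-addord's road with
the PRINTED congruence `hGV` (GV Thm. (3.12) on the branch) exists; this file is the `hGV`-FREE road,
which also covers the anomalous twists (`a_p(V) ≡ 1`) and, at `p = 3`, drops the non-anomaly
hypothesis of `ClassX3Gord.bsdp_three_rankZero_of_facts_of_lifting_of_nonAnomalous`.

* `X3Branch.lamEqW_of_facts_of_charCerts` (ramified even line), `X3Branch.lamEqW_of_facts_of_lifting_of_charCerts`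
  (even line with non-trivial action + displayed lifting);
* `ClassX3Gord.bsdp_rankZero_of_unitCoeffCert_of_charCerts` (`p ≥ 5`),
  `ClassX3Gord.bsdp_three_rankZero_of_unitCoeffCert_of_charCerts` (`p = 3`, NON-degenerate) and its
  `…_of_liftingFact` twin (the lifting `hlift` discharged by `residualEpsilon_surjOn_of_lineEven`).

What this is NOT: not the DEGENERATE rows (`φ = 1`, `ψ = ω`); not rank `1`; not a booking.

References: [GreenbergVatsal2000] §2 pp. 26–30, §3 pp. 41–43; [Greenberg2001PastPresent] §6 p. 367;
[Delbourgo1998] Prop. 4; [Wuthrich2014] Thm. 16, Cor. 18; [Pal2012] Thm. 3.2; [GreenbergLNM1716]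
Props. 2.2, 2.4, 4.14; [Miller2011LMS] Def. 1.1.
-/

set_option autoImplicit false

noncomputable section

open scoped Classical

namespace Summit.BirchSwinnertonDyer.Rank1Residual.Additive

open WeierstrassCurve NumberField IsDedekindDomain Field
  Literature.NumberTheory.EllipticCurves
  Literature.NumberTheory.EllipticCurves.ModularForms
  Literature.NumberTheory.EllipticCurves.GreenbergVatsal2000
  Literature.NumberTheory.EllipticCurves.Rank1Residual
  Literature.NumberTheory.EllipticCurves.Rank1Residual.Typed
  Literature.NumberTheory.GaloisRepresentations
  Summit.BirchSwinnertonDyer.Rank1Residual.X1.MuLambda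
  Summit.BirchSwinnertonDyer.Rank1Residual.AdditivePotMult
  Summit.BirchSwinnertonDyer.Rank1Residual.Additive.X3Branch

variable {W : WeierstrassCurve ℚ} [W.IsElliptic] [W.IsGloballyMinimal] {p : ℕ} [hp : Fact p.Prime]

/-! ### X3♯(G-ord, `e = 2`): `hLamW` and the end states from the character facts + three certificates -/

/-- **(G-ord, `e = 2`), ramified even line (`p ≥ 5` shape): `hLamW` from the PUBLISHED records `h23`,
`h414`, `hGrK`, `hLiftF`, `hC`, `hD` + the line datum + two `λ`-certificates**
(`X3Branch.lamEqW_of_facts_of_eval` with `hn` from `X3Branch.eval_of_charFacts_of_certs`; the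
non-trivial action follows from the ramification of the line, bsd-addord's
`exists_smul_ne_of_not_lineUnramifiedAt`). [cite: GreenbergLNM1716, Props. 2.2, 2.4, 4.14]
[cite: GreenbergVatsal2000, §2 pp. 26–30 (display (16), (11)), Props. (2.6), (2.8), Cor. (2.3); §3 pp. 41–43] -/
theorem X3Branch.lamEqW_of_facts_of_charCerts
    (h23 : datumSelmer_nonPrimitive_invariants)
    (h414 : Greenberg1999.prop414_noFiniteSubmodule_of_not_dvd_torsionOrder)
    (hGrK : Greenberg1999.imKummer_ge_strictCondition_goodOrdinary)
    (hLiftF : residualEpsilon_surjOn_of_lineRamifiedEven)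
    (hC : characterLFunctionC_hasUnitContent_and_order_eq_card_of_ne_one)
    (hD : characterLFunctionD_hasUnitContent_and_order_eq_card_of_ne_teichmuller)
    (hp2 : p ≠ 2) (V : WeierstrassCurve ℚ) [V.IsElliptic] [V.IsGloballyMinimal] (hV : GoodOrd V p)
    {C : VariableChange ℚ} (hCV : C • V.quadraticTwist ((-1 : ℚ) ^ (p / 2) * p) = W)
    (S₀ : Finset (HeightOneSpectrum (𝓞 ℚ))) (hS₀ : ∀ v ∈ S₀, ((p : ℕ) : 𝓞 ℚ) ∉ v.asIdeal)
    (hS : ∀ v : HeightOneSpectrum (𝓞 ℚ), v ∉ S₀ → ((p : ℕ) : 𝓞 ℚ) ∉ v.asIdeal →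
      W.HasGoodReductionAt v)
    (Φ₀ : AddSubgroup (W.geomTorsion (p : ℤ))) (hΦ : IsRationalLine W p Φ₀)
    (hram0 : ¬ LineUnramifiedAt W p Φ₀) (heven : LineEven W p Φ₀)
    (hram : ∀ (K : Type) [Field K] [NumberField K] [(galRange (K := ℚ) K).Normal],
      Module.finrank ℚ K = 2 → (∃ θ : K, θ ^ 2 = algebraMap ℚ K ((-1) ^ (p / 2) * p)) →
      ¬ ∀ v : HeightOneSpectrum (𝓞 ℚ), ((p : ℕ) : 𝓞 ℚ) ∈ v.asIdeal →
        ∀ 𝔓 ∈ v.primesAbove, ∀ σ ∈ 𝔓.inertia (absoluteGaloisGroup ℚ), ∀ P ∈ Φ₀,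
          σ • P = (if σ ∈ galRange (K := ℚ) K then P else -P))
    {a b n : ℕ} (hab : a + b = n + ∑ v ∈ S₀, delta W p v)
    (hCcert : ∀ (m : ℕ) [NeZero m] (φ : DirichletCharacter (ZMod p) m), φ.IsPrimitive →
      (∀ (σ : absoluteGaloisGroup ℚ), ∀ P ∈ Φ₀,
        σ • P = (φ ((modNCyclotomicCharacter ℚ m σ : (ZMod m)ˣ) : ZMod m)).val • P) →
      ∀ g : IwasawaAlgebra p, IsCharacterLFunctionC p φ S₀ g →
        (PowerSeries.map (PadicInt.toZMod (p := p)) g).order.toNat = a)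
    (hDcert : ∀ (d : ℕ) [NeZero d] (ψ : DirichletCharacter (ZMod p) d), ψ.IsPrimitive →
      (∀ (σ : absoluteGaloisGroup ℚ) (P : W.geomTorsion (p : ℤ)),
        σ • P - (ψ ((modNCyclotomicCharacter ℚ d σ : (ZMod d)ˣ) : ZMod d)).val • P ∈ Φ₀) →
      ∀ g : IwasawaAlgebra p, IsCharacterLFunctionD p ψ S₀ g →
        (PowerSeries.map (PadicInt.toZMod (p := p)) g).order.toNat = b)
    {κ : ZpExtension ℚ p} {γ : Field.absoluteGaloisGroup ℚ} (D : W.SelmerDualData κ γ)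
    (g : IwasawaAlgebra p) (hκ : κ.IsCyclotomic) (hγ : κ.IsTopGenerator γ) (hDt : D.IsTorsion)
    (hchar : D.charIdeal = Ideal.span {g}) (hμg : HasUnitContent g) : lam g = n :=
  X3Branch.lamEqW_of_facts_of_eval h23 h414 hGrK hLiftF hp2 V hV hCV S₀ hS₀ hS Φ₀ hΦ hram0 heven hram
    (X3Branch.eval_of_charFacts_of_certs hC hD hp2 S₀ hS₀ hS Φ₀ hΦ heven
      (exists_smul_ne_of_not_lineUnramifiedAt hΦ hram0) hab hCcert hDcert)
    D g hκ hγ hDt hchar hμg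

/-- **(G-ord, `e = 2`), even line with non-trivial action and a DISPLAYED residual lifting
(`p = 3` non-degenerate shape): `hLamW` from `h23`, `h414`, `hGrK`, `hC`, `hD` + `Φ₀` + `hlift` + two
`λ`-certificates** (`X3Branch.lamEqW_of_facts_of_lifting_of_eval` with `hn` from
`X3Branch.eval_of_charFacts_of_certs`). [cite: GreenbergLNM1716, Props. 2.2, 2.4, 4.14]
[cite: GreenbergVatsal2000, §2 pp. 26–30 (display (16), (11)), Props. (2.6), (2.8), Cor. (2.3); §3 pp. 41–43] -/
theorem X3Branch.lamEqW_of_facts_of_lifting_of_charCerts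
    (h23 : datumSelmer_nonPrimitive_invariants)
    (h414 : Greenberg1999.prop414_noFiniteSubmodule_of_not_dvd_torsionOrder)
    (hGrK : Greenberg1999.imKummer_ge_strictCondition_goodOrdinary)
    (hC : characterLFunctionC_hasUnitContent_and_order_eq_card_of_ne_one)
    (hD : characterLFunctionD_hasUnitContent_and_order_eq_card_of_ne_teichmuller)
    (hp2 : p ≠ 2) (V : WeierstrassCurve ℚ) [V.IsElliptic] [V.IsGloballyMinimal] (hV : GoodOrd V p)
    {C : VariableChange ℚ} (hCV : C • V.quadraticTwist ((-1 : ℚ) ^ (p / 2) * p) = W)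
    (S₀ : Finset (HeightOneSpectrum (𝓞 ℚ))) (hS₀ : ∀ v ∈ S₀, ((p : ℕ) : 𝓞 ℚ) ∉ v.asIdeal)
    (hS : ∀ v : HeightOneSpectrum (𝓞 ℚ), v ∉ S₀ → ((p : ℕ) : 𝓞 ℚ) ∉ v.asIdeal →
      W.HasGoodReductionAt v)
    (Φ₀ : AddSubgroup (W.geomTorsion (p : ℤ))) (hΦ : IsRationalLine W p Φ₀)
    (heven : LineEven W p Φ₀)
    (hnt : ∃ (σ : absoluteGaloisGroup ℚ) (P : W.geomTorsion (p : ℤ)), P ∈ Φ₀ ∧ σ • P ≠ P)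
    (hram : ∀ (K : Type) [Field K] [NumberField K] [(galRange (K := ℚ) K).Normal],
      Module.finrank ℚ K = 2 → (∃ θ : K, θ ^ 2 = algebraMap ℚ K ((-1) ^ (p / 2) * p)) →
      ¬ ∀ v : HeightOneSpectrum (𝓞 ℚ), ((p : ℕ) : 𝓞 ℚ) ∈ v.asIdeal →
        ∀ 𝔓 ∈ v.primesAbove, ∀ σ ∈ 𝔓.inertia (absoluteGaloisGroup ℚ), ∀ P ∈ Φ₀,
          σ • P = (if σ ∈ galRange (K := ℚ) K then P else -P))
    (hlift : ∀ (κ : ZpExtension ℚ p), κ.IsCyclotomic →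
      ∀ s ∈ residualQuotSelmer W p κ S₀ Φ₀ hΦ, ∃ x ∈ residualTorsionH1 W p κ S₀,
        residualEpsilon W p κ Φ₀ hΦ x = s)
    {a b n : ℕ} (hab : a + b = n + ∑ v ∈ S₀, delta W p v)
    (hCcert : ∀ (m : ℕ) [NeZero m] (φ : DirichletCharacter (ZMod p) m), φ.IsPrimitive →
      (∀ (σ : absoluteGaloisGroup ℚ), ∀ P ∈ Φ₀,
        σ • P = (φ ((modNCyclotomicCharacter ℚ m σ : (ZMod m)ˣ) : ZMod m)).val • P) →
      ∀ g : IwasawaAlgebra p, IsCharacterLFunctionC p φ S₀ g →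
        (PowerSeries.map (PadicInt.toZMod (p := p)) g).order.toNat = a)
    (hDcert : ∀ (d : ℕ) [NeZero d] (ψ : DirichletCharacter (ZMod p) d), ψ.IsPrimitive →
      (∀ (σ : absoluteGaloisGroup ℚ) (P : W.geomTorsion (p : ℤ)),
        σ • P - (ψ ((modNCyclotomicCharacter ℚ d σ : (ZMod d)ˣ) : ZMod d)).val • P ∈ Φ₀) →
      ∀ g : IwasawaAlgebra p, IsCharacterLFunctionD p ψ S₀ g →
        (PowerSeries.map (PadicInt.toZMod (p := p)) g).order.toNat = b)
    {κ : ZpExtension ℚ p} {γ : Field.absoluteGaloisGroup ℚ} (D : W.SelmerDualData κ γ)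
    (g : IwasawaAlgebra p) (hκ : κ.IsCyclotomic) (hγ : κ.IsTopGenerator γ) (hDt : D.IsTorsion)
    (hchar : D.charIdeal = Ideal.span {g}) (hμg : HasUnitContent g) : lam g = n :=
  X3Branch.lamEqW_of_facts_of_lifting_of_eval h23 h414 hGrK hp2 V hV hCV S₀ hS₀ hS Φ₀ hΦ heven hnt hram
    hlift (X3Branch.eval_of_charFacts_of_certs hC hD hp2 S₀ hS₀ hS Φ₀ hΦ heven hnt hab hCcert hDcert)
    D g hκ hγ hDt hchar hμg

/-- **X3♯(G-ord) ∩ `I₀*` (`e = 2`), `p ≥ 5`, `r_an = 0`, ramified even line, anomalous twists included: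
Miller's `BSD(E,p)`** from the PUBLISHED records `hDelG`, `hDel98`, `hGZK`, `hmod`, `hmodD`, `hW16`,
`h23`, `h414`, `hGrK`, `hLiftF`, `hC`, `hD` + the line datum + the THREE instrument certificates
(`hcert`, `hCcert`, `hDcert`) — the `hGV`-free certificate road
`ClassX3Gord.bsdp_rankZero_of_unitCoeffCert_of_lamEqW` with `hLamW` from above. NOT a class theorem;
nothing booked. [cite: Delbourgo1998, Prop. 4 (p. 144)] [cite: Wuthrich2014, Thm. 16 (p. 397), Cor. 18]
[cite: Pal2012, Thm. 3.2] [cite: GreenbergVatsal2000, §2 pp. 26–30, §3 pp. 41–43] [cite: Miller2011LMS, §1 and Def. 1.1] -/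
theorem ClassX3Gord.bsdp_rankZero_of_unitCoeffCert_of_charCerts
    (hDelG : Delbourgo1998.prop4_rankZero_constantCoeff_eq_unit_mul_of_potGoodOrd)
    (hDel98 : Delbourgo1998.prop4_rankZero_pow_dvd_constantCoeff)
    (hGZK : rank_eq_analyticRank_of_analyticRank_le_one) (hmod : hasEntireLFunction_rat)
    (hmodD : nonempty_modularParametrizationData)
    (hW16 : Wuthrich2014.thm16_halfEigenCharIdeal_dvd_cyclotomicPrime)
    (h23 : datumSelmer_nonPrimitive_invariants)
    (h414 : Greenberg1999.prop414_noFiniteSubmodule_of_not_dvd_torsionOrder)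
    (hGrK : Greenberg1999.imKummer_ge_strictCondition_goodOrdinary)
    (hLiftF : residualEpsilon_surjOn_of_lineRamifiedEven)
    (hC : characterLFunctionC_hasUnitContent_and_order_eq_card_of_ne_one)
    (hD : characterLFunctionD_hasUnitContent_and_order_eq_card_of_ne_teichmuller)
    (hX : ClassX3Gord W p) (hp5 : 5 ≤ p) (he : semistabilityIndex W p = 2) (hr : W.analyticRank = 0)
    (S₀ : Finset (HeightOneSpectrum (𝓞 ℚ))) (hS₀ : ∀ v ∈ S₀, ((p : ℕ) : 𝓞 ℚ) ∉ v.asIdeal)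
    (hS : ∀ v : HeightOneSpectrum (𝓞 ℚ), v ∉ S₀ → ((p : ℕ) : 𝓞 ℚ) ∉ v.asIdeal →
      W.HasGoodReductionAt v)
    (Φ₀ : AddSubgroup (W.geomTorsion (p : ℤ))) (hΦ : IsRationalLine W p Φ₀)
    (hram0 : ¬ LineUnramifiedAt W p Φ₀) (heven : LineEven W p Φ₀)
    (hram : ∀ (K : Type) [Field K] [NumberField K] [(galRange (K := ℚ) K).Normal],
      Module.finrank ℚ K = 2 → (∃ θ : K, θ ^ 2 = algebraMap ℚ K ((-1) ^ (p / 2) * p)) →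
      ¬ ∀ v : HeightOneSpectrum (𝓞 ℚ), ((p : ℕ) : 𝓞 ℚ) ∈ v.asIdeal →
        ∀ 𝔓 ∈ v.primesAbove, ∀ σ ∈ 𝔓.inertia (absoluteGaloisGroup ℚ), ∀ P ∈ Φ₀,
          σ • P = (if σ ∈ galRange (K := ℚ) K then P else -P))
    {a b n : ℕ} (hab : a + b = n + ∑ v ∈ S₀, delta W p v)
    (hcert : ∀ (V : WeierstrassCurve ℚ) [V.IsElliptic] [V.IsGloballyMinimal] (C : VariableChange ℚ),
      C • V.quadraticTwist ((-1) ^ (p / 2) * p : ℚ) = W → X3BranchUnitCoeffCertAt V p n)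
    (hCcert : ∀ (m : ℕ) [NeZero m] (φ : DirichletCharacter (ZMod p) m), φ.IsPrimitive →
      (∀ (σ : absoluteGaloisGroup ℚ), ∀ P ∈ Φ₀,
        σ • P = (φ ((modNCyclotomicCharacter ℚ m σ : (ZMod m)ˣ) : ZMod m)).val • P) →
      ∀ g : IwasawaAlgebra p, IsCharacterLFunctionC p φ S₀ g →
        (PowerSeries.map (PadicInt.toZMod (p := p)) g).order.toNat = a)
    (hDcert : ∀ (d : ℕ) [NeZero d] (ψ : DirichletCharacter (ZMod p) d), ψ.IsPrimitive →
      (∀ (σ : absoluteGaloisGroup ℚ) (P : W.geomTorsion (p : ℤ)),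
        σ • P - (ψ ((modNCyclotomicCharacter ℚ d σ : (ZMod d)ˣ) : ZMod d)).val • P ∈ Φ₀) →
      ∀ g : IwasawaAlgebra p, IsCharacterLFunctionD p ψ S₀ g →
        (PowerSeries.map (PadicInt.toZMod (p := p)) g).order.toNat = b) :
    BSDp W p := by
  have hp2 : p ≠ 2 := by omega
  obtain ⟨V, _, _, C, hV, hCV⟩ := ClassX3Gord.exists_goodOrd_pStar_twist_model W p hp2 hX he
  exact ClassX3Gord.bsdp_rankZero_of_unitCoeffCert_of_lamEqW hDelG hDel98 hGZK hmod hmodD hW16 hX hp5 he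
    hr hcert
    (fun D g hκ hγ hDt hchar hμg ↦ X3Branch.lamEqW_of_facts_of_charCerts h23 h414 hGrK hLiftF hC hD hp2
      V hV hCV S₀ hS₀ hS Φ₀ hΦ hram0 heven hram hab hCcert hDcert D g hκ hγ hDt hchar hμg)

/-- **X3♯(G-ord) ∩ `I₀*` at `p = 3`, `r_an = 0`, NON-degenerate rows (`Φ₀` even with non-trivial
action — `W[3]^{ss} ≠ {1, ω}`; anomalous twists `a₃(V) ≡ 1` INCLUDED): Miller's `BSD(E,3)`** from the
PUBLISHED records + the line datum + `hlift` + the THREE instrument certificates — the `hGV`-free twin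
of bsd-addord's `ClassX3Gord.bsdp_three_rankZero_of_facts_of_lifting_of_nonAnomalous` without its
non-anomaly hypothesis (certificate road `ClassX3Gord.bsdp_three_rankZero_of_unitCoeffCert_of_lamEqW`).
NOT a class theorem; nothing booked. [cite: Delbourgo1998, Prop. 4 (p. 144)] [cite: Wuthrich2014, Thm. 16 (p. 397)]
[cite: GreenbergVatsal2000, §2 pp. 26–30, §3 pp. 41–43] [cite: Miller2011LMS, §1 and Def. 1.1] -/
theorem ClassX3Gord.bsdp_three_rankZero_of_unitCoeffCert_of_charCerts [Fact (Nat.Prime 3)]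
    {W : WeierstrassCurve ℚ} [W.IsElliptic] [W.IsGloballyMinimal]
    (hDelG : Delbourgo1998.prop4_rankZero_constantCoeff_eq_unit_mul_of_potGoodOrd)
    (hDel98 : Delbourgo1998.prop4_rankZero_pow_dvd_constantCoeff)
    (hGZK : rank_eq_analyticRank_of_analyticRank_le_one) (hmod : hasEntireLFunction_rat)
    (hmodD : nonempty_modularParametrizationData)
    (hW16 : Wuthrich2014.thm16_halfEigenCharIdeal_dvd_cyclotomicPrime)
    (h23 : datumSelmer_nonPrimitive_invariants)
    (h414 : Greenberg1999.prop414_noFiniteSubmodule_of_not_dvd_torsionOrder)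
    (hGrK : Greenberg1999.imKummer_ge_strictCondition_goodOrdinary)
    (hC : characterLFunctionC_hasUnitContent_and_order_eq_card_of_ne_one)
    (hD : characterLFunctionD_hasUnitContent_and_order_eq_card_of_ne_teichmuller)
    (hX : ClassX3Gord W 3) (hr : W.analyticRank = 0)
    (S₀ : Finset (HeightOneSpectrum (𝓞 ℚ))) (hS₀ : ∀ v ∈ S₀, (((3 : ℕ) : ℕ) : 𝓞 ℚ) ∉ v.asIdeal)
    (hS : ∀ v : HeightOneSpectrum (𝓞 ℚ), v ∉ S₀ → (((3 : ℕ) : ℕ) : 𝓞 ℚ) ∉ v.asIdeal →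
      W.HasGoodReductionAt v)
    (Φ₀ : AddSubgroup (W.geomTorsion ((3 : ℕ) : ℤ))) (hΦ : IsRationalLine W 3 Φ₀)
    (heven : LineEven W 3 Φ₀)
    (hnt : ∃ (σ : absoluteGaloisGroup ℚ) (P : W.geomTorsion ((3 : ℕ) : ℤ)), P ∈ Φ₀ ∧ σ • P ≠ P)
    (hram : ∀ (K : Type) [Field K] [NumberField K] [(galRange (K := ℚ) K).Normal],
      Module.finrank ℚ K = 2 →
      (∃ θ : K, θ ^ 2 = algebraMap ℚ K ((-1) ^ ((3 : ℕ) / 2) * (3 : ℕ))) →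
      ¬ ∀ v : HeightOneSpectrum (𝓞 ℚ), (((3 : ℕ) : ℕ) : 𝓞 ℚ) ∈ v.asIdeal →
        ∀ 𝔓 ∈ v.primesAbove, ∀ σ ∈ 𝔓.inertia (absoluteGaloisGroup ℚ), ∀ P ∈ Φ₀,
          σ • P = (if σ ∈ galRange (K := ℚ) K then P else -P))
    (hlift : ∀ (κ : ZpExtension ℚ 3), κ.IsCyclotomic →
      ∀ s ∈ residualQuotSelmer W 3 κ S₀ Φ₀ hΦ, ∃ x ∈ residualTorsionH1 W 3 κ S₀,
        residualEpsilon W 3 κ Φ₀ hΦ x = s)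
    {a b n : ℕ} (hab : a + b = n + ∑ v ∈ S₀, delta W 3 v)
    (hcert : ∀ (V : WeierstrassCurve ℚ) [V.IsElliptic] [V.IsGloballyMinimal] (C : VariableChange ℚ),
      C • V.quadraticTwist ((-1) ^ ((3 : ℕ) / 2) * (3 : ℕ) : ℚ) = W → X3BranchUnitCoeffCertAt V 3 n)
    (hCcert : ∀ (m : ℕ) [NeZero m] (φ : DirichletCharacter (ZMod 3) m), φ.IsPrimitive →
      (∀ (σ : absoluteGaloisGroup ℚ), ∀ P ∈ Φ₀,
        σ • P = (φ ((modNCyclotomicCharacter ℚ m σ : (ZMod m)ˣ) : ZMod m)).val • P) →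
      ∀ g : IwasawaAlgebra 3, IsCharacterLFunctionC 3 φ S₀ g →
        (PowerSeries.map (PadicInt.toZMod (p := 3)) g).order.toNat = a)
    (hDcert : ∀ (d : ℕ) [NeZero d] (ψ : DirichletCharacter (ZMod 3) d), ψ.IsPrimitive →
      (∀ (σ : absoluteGaloisGroup ℚ) (P : W.geomTorsion ((3 : ℕ) : ℤ)),
        σ • P - (ψ ((modNCyclotomicCharacter ℚ d σ : (ZMod d)ˣ) : ZMod d)).val • P ∈ Φ₀) →
      ∀ g : IwasawaAlgebra 3, IsCharacterLFunctionD 3 ψ S₀ g →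
        (PowerSeries.map (PadicInt.toZMod (p := 3)) g).order.toNat = b) :
    BSDp W 3 := by
  have he : semistabilityIndex W 3 = 2 :=
    semistabilityIndex_eq_two_of_typeG_three W hX.typeGOrd.typeG hX.addv
  obtain ⟨V, _, _, C, hV, hCV⟩ := ClassX3Gord.exists_goodOrd_pStar_twist_model W 3 (by norm_num) hX he
  exact ClassX3Gord.bsdp_three_rankZero_of_unitCoeffCert_of_lamEqW hDelG hDel98 hGZK hmod hmodD hW16 hX
    hr hcert
    (fun D g hκ hγ hDt hchar hμg ↦ X3Branch.lamEqW_of_facts_of_lifting_of_charCerts h23 h414 hGrK hC hD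
      (by norm_num) V hV hCV S₀ hS₀ hS Φ₀ hΦ heven hnt hram hlift hab hCcert hDcert D g hκ hγ hDt hchar
      hμg)

/-- **X3♯(G-ord) ∩ `I₀*` at `p = 3`, `r_an = 0`, NON-degenerate rows: `BSD(E,3)` with the residual
lifting DISCHARGED by the reading-fact `residualEpsilon_surjOn_of_lineEven`** — per pair: PUBLISHED
records + the line datum (bsd-addord's Hesse-type certificate `exists_lineDatum_three_of_cert` supplies
`Φ₀` rational, even, with non-trivial action and ramified `χ_K`-twist) + THREE instrument certificates +
the bookkeeping `hab`. NOT a class theorem; nothing booked. [cite: GreenbergVatsal2000, §2 pp. 28–30, §3 pp. 41–43]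
[cite: Delbourgo1998, Prop. 4 (p. 144)] [cite: Wuthrich2014, Thm. 16 (p. 397)] [cite: Miller2011LMS, §1 and Def. 1.1] -/
theorem ClassX3Gord.bsdp_three_rankZero_of_unitCoeffCert_of_charCerts_of_liftingFact [Fact (Nat.Prime 3)]
    {W : WeierstrassCurve ℚ} [W.IsElliptic] [W.IsGloballyMinimal]
    (hDelG : Delbourgo1998.prop4_rankZero_constantCoeff_eq_unit_mul_of_potGoodOrd)
    (hDel98 : Delbourgo1998.prop4_rankZero_pow_dvd_constantCoeff)
    (hGZK : rank_eq_analyticRank_of_analyticRank_le_one) (hmod : hasEntireLFunction_rat)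
    (hmodD : nonempty_modularParametrizationData)
    (hW16 : Wuthrich2014.thm16_halfEigenCharIdeal_dvd_cyclotomicPrime)
    (h23 : datumSelmer_nonPrimitive_invariants)
    (h414 : Greenberg1999.prop414_noFiniteSubmodule_of_not_dvd_torsionOrder)
    (hGrK : Greenberg1999.imKummer_ge_strictCondition_goodOrdinary)
    (hLiftE : residualEpsilon_surjOn_of_lineEven)
    (hC : characterLFunctionC_hasUnitContent_and_order_eq_card_of_ne_one)
    (hD : characterLFunctionD_hasUnitContent_and_order_eq_card_of_ne_teichmuller)
    (hX : ClassX3Gord W 3) (hr : W.analyticRank = 0)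
    (S₀ : Finset (HeightOneSpectrum (𝓞 ℚ))) (hS₀ : ∀ v ∈ S₀, (((3 : ℕ) : ℕ) : 𝓞 ℚ) ∉ v.asIdeal)
    (hS : ∀ v : HeightOneSpectrum (𝓞 ℚ), v ∉ S₀ → (((3 : ℕ) : ℕ) : 𝓞 ℚ) ∉ v.asIdeal →
      W.HasGoodReductionAt v)
    (Φ₀ : AddSubgroup (W.geomTorsion ((3 : ℕ) : ℤ))) (hΦ : IsRationalLine W 3 Φ₀)
    (heven : LineEven W 3 Φ₀)
    (hnt : ∃ (σ : absoluteGaloisGroup ℚ) (P : W.geomTorsion ((3 : ℕ) : ℤ)), P ∈ Φ₀ ∧ σ • P ≠ P)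
    (hram : ∀ (K : Type) [Field K] [NumberField K] [(galRange (K := ℚ) K).Normal],
      Module.finrank ℚ K = 2 →
      (∃ θ : K, θ ^ 2 = algebraMap ℚ K ((-1) ^ ((3 : ℕ) / 2) * (3 : ℕ))) →
      ¬ ∀ v : HeightOneSpectrum (𝓞 ℚ), (((3 : ℕ) : ℕ) : 𝓞 ℚ) ∈ v.asIdeal →
        ∀ 𝔓 ∈ v.primesAbove, ∀ σ ∈ 𝔓.inertia (absoluteGaloisGroup ℚ), ∀ P ∈ Φ₀,
          σ • P = (if σ ∈ galRange (K := ℚ) K then P else -P))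
    {a b n : ℕ} (hab : a + b = n + ∑ v ∈ S₀, delta W 3 v)
    (hcert : ∀ (V : WeierstrassCurve ℚ) [V.IsElliptic] [V.IsGloballyMinimal] (C : VariableChange ℚ),
      C • V.quadraticTwist ((-1) ^ ((3 : ℕ) / 2) * (3 : ℕ) : ℚ) = W → X3BranchUnitCoeffCertAt V 3 n)
    (hCcert : ∀ (m : ℕ) [NeZero m] (φ : DirichletCharacter (ZMod 3) m), φ.IsPrimitive →
      (∀ (σ : absoluteGaloisGroup ℚ), ∀ P ∈ Φ₀,
        σ • P = (φ ((modNCyclotomicCharacter ℚ m σ : (ZMod m)ˣ) : ZMod m)).val • P) →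
      ∀ g : IwasawaAlgebra 3, IsCharacterLFunctionC 3 φ S₀ g →
        (PowerSeries.map (PadicInt.toZMod (p := 3)) g).order.toNat = a)
    (hDcert : ∀ (d : ℕ) [NeZero d] (ψ : DirichletCharacter (ZMod 3) d), ψ.IsPrimitive →
      (∀ (σ : absoluteGaloisGroup ℚ) (P : W.geomTorsion ((3 : ℕ) : ℤ)),
        σ • P - (ψ ((modNCyclotomicCharacter ℚ d σ : (ZMod d)ˣ) : ZMod d)).val • P ∈ Φ₀) →
      ∀ g : IwasawaAlgebra 3, IsCharacterLFunctionD 3 ψ S₀ g →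
        (PowerSeries.map (PadicInt.toZMod (p := 3)) g).order.toNat = b) :
    BSDp W 3 :=
  ClassX3Gord.bsdp_three_rankZero_of_unitCoeffCert_of_charCerts hDelG hDel98 hGZK hmod hmodD hW16 h23 h414
    hGrK hC hD hX hr S₀ hS₀ hS Φ₀ hΦ heven hnt hram
    (fun κ hκ ↦ hLiftE W 3 κ S₀ Φ₀ hΦ (by norm_num) hκ heven hS₀ hS) hab hcert hCcert hDcert

end Summit.BirchSwinnertonDyer.Rank1Residual.Additive

end
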